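import Literature.Topology.FourManifolds.SphereFamilySurgery
import Literature.Topology.FourManifolds.SmoothEmbeddingCriteria
import Mathlib.Analysis.InnerProductSpace.Calculus
import HarnessLib

/-!
# Crux `WeakReductionDescent.DependentTripleGenusThreeStandard` (stmt-SmoothPoincare4-18000), line
# `Sketch` — surgery inversion I: the core circle of the new piece of a sphere surgery and its tube

First auxiliary file of the registered helper `helper_isCircleSurgery_of_isSurgery_sphereTwo`
(`--supports stmt-SmoothPoincare4-18000`: a sphere surgery of type `(3, 2)` in a 4-manifold is
undone by a circle surgery — Aranda–Zupan 2025, Prop. 5.5; Gompf–Stipsicz 1999, §5.2).  Model-space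
plumbing, independent of the surgered manifold:

* the squeeze `σ(y) = y/√(1 + ‖y‖²)` of a Euclidean space onto its open unit ball (Mathlib's
  `OpenPartialHomeomorph.univUnitBall`) and its radial profile `θ(t) = t/√(1 + t²) ∈ (0, 1)`;
* `SurgeryInversion.exists_theta`: the reparametrisation `S¹ × ℝ³ ≅ Unit × OD³ × S¹`,
  `(u, y) ↦ (⋆, σ y, u)`, of the new piece `ballTimesSphere Unit 2 1` of
  `SphereFamilySurgery.lean` over the whole fibre — a homeomorphism, smooth with smooth inverse;
* `SurgeryInversion.exists_circleNbhd_core`: for an open smooth embedding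
  `jB : Unit × OD³ × S¹ ↪ X′`, the core circle `ℓ(u) = jB(⋆, 0, u)` has the tubular neighbourhood
  (`CircleNbhd`) `(u, y) ↦ jB(⋆, σ y, u)`, a smooth embedding by the tree's criterion
  `isSmoothEmbedding_of_openPartialHomeomorph` (the inverse of `jB` is smooth,
  `contMDiffOn_symm_of_isSmoothEmbedding`), with image `jB(Unit × OD³ × S¹)`;
* the registered lemma `helper_exists_circleNbhd_newPieceCore` packaging the last item.

Everything here is proved; no definition, no named fact.

References: R. Gompf, A. Stipsicz, *4-Manifolds and Kirby Calculus*, GSM 20 (1999), §5.2;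
J. Milnor, *Lectures on the h-cobordism theorem* (1965), Def. 3.11 (PDF p. 17).
-/

-- the registered namespace `Summit.SmoothPoincare4.SmoothPoincare4.Theorems…` repeats a component
set_option linter.dupNamespace false

noncomputable section

open scoped Manifold ContDiff Topology
open Set Function Metric Topology
open Literature.Topology.FourManifolds

namespace Summit.SmoothPoincare4.SmoothPoincare4.Theorems

namespace SurgeryInversion

/-! ### The squeeze `y ↦ y/√(1 + ‖y‖²)` of a Euclidean space onto its open unit ball -/

section Squeeze

variable {E : Type*} [NormedAddCommGroup E] [InnerProductSpace ℝ E]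

/-- The squeeze lands in the open unit ball. [folklore] -/
theorem norm_univUnitBall_lt (x : E) : ‖OpenPartialHomeomorph.univUnitBall x‖ < 1 :=
  mem_ball_zero_iff.1 (OpenPartialHomeomorph.univUnitBall.map_source (mem_univ x))

/-- The squeeze is continuous. [folklore] -/
theorem continuous_univUnitBall : Continuous (OpenPartialHomeomorph.univUnitBall : E → E) :=
  (OpenPartialHomeomorph.contDiff_univUnitBall (n := 0)).continuous

/-- The radial profile `θ(t) = t/√(1 + t²)` of the squeeze takes `(0, ∞)` into `(0, 1)`. [folklore] -/
theorem profile_mem_Ioo {t : ℝ} (ht : 0 < t) : t * (Real.sqrt (1 + t ^ 2))⁻¹ ∈ Ioo (0 : ℝ) 1 := by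
  have hs : 0 < Real.sqrt (1 + t ^ 2) := Real.sqrt_pos.2 (by positivity)
  refine ⟨by positivity, ?_⟩
  have h1 : t < Real.sqrt (1 + t ^ 2) := by
    rw [Real.lt_sqrt ht.le]; linarith
  rw [mul_inv_lt_iff₀ hs]
  linarith

/-- The squeeze of `t • u`, `‖u‖ = 1`, `t ≥ 0`, is `θ(t) • u`. [folklore] -/
theorem univUnitBall_smul {u : E} (hu : ‖u‖ = 1) {t : ℝ} (ht : 0 ≤ t) :
    OpenPartialHomeomorph.univUnitBall (t • u) = (t * (Real.sqrt (1 + t ^ 2))⁻¹) • u := by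
  rw [OpenPartialHomeomorph.univUnitBall_apply, norm_smul, hu, mul_one, Real.norm_eq_abs,
    abs_of_nonneg ht, smul_smul, mul_comm]

/-- The squeeze vanishes only at the origin. [folklore] -/
theorem univUnitBall_eq_zero_iff {x : E} : OpenPartialHomeomorph.univUnitBall x = 0 ↔ x = 0 := by
  rw [OpenPartialHomeomorph.univUnitBall_apply, smul_eq_zero]
  have : (Real.sqrt (1 + ‖x‖ ^ 2))⁻¹ ≠ 0 := inv_ne_zero (Real.sqrt_pos.2 (by positivity)).ne'
  simp [this]

end Squeeze

/-! ### The new piece `Unit × OD³ × S¹` reparametrised over `S¹ × ℝ³` -/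

/-- **The reparametrisation `S¹ × ℝ³ ≅ Unit × OD³ × S¹`, `(u, y) ↦ (⋆, y/√(1 + ‖y‖²), u)`**, of the
new piece of the sphere surgery (swap the factors and squeeze the fibre `ℝ³` onto `OD³`): a
homeomorphism which is smooth with smooth inverse for the product models. [folklore] -/
theorem exists_theta :
    ∃ θ : (Metric.sphere (0 : EuclideanSpace ℝ (Fin 2)) 1) × EuclideanSpace ℝ (Fin 3) ≃ₜ
        ↥(ballTimesSphere Unit 2 1),
      ContMDiff ((𝓡 1).prod 𝓘(ℝ, EuclideanSpace ℝ (Fin 3))) ((𝓡 0).prod ((𝓡 3).prod (𝓡 1))) ∞ θ ∧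
      ContMDiff ((𝓡 0).prod ((𝓡 3).prod (𝓡 1))) ((𝓡 1).prod 𝓘(ℝ, EuclideanSpace ℝ (Fin 3))) ∞ θ.symm ∧
      ∀ p, (θ p : DiscreteIndex Unit ×
          (EuclideanSpace ℝ (Fin 3) × (Metric.sphere (0 : EuclideanSpace ℝ (Fin 2)) 1))) =
        (DiscreteIndex.mk (), OpenPartialHomeomorph.univUnitBall p.2, p.1) := by
  let θ : (Metric.sphere (0 : EuclideanSpace ℝ (Fin 2)) 1) × EuclideanSpace ℝ (Fin 3) ≃ₜ
      ↥(ballTimesSphere Unit 2 1) :=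
    { toFun := fun p => ⟨(DiscreteIndex.mk (), OpenPartialHomeomorph.univUnitBall p.2, p.1),
        norm_univUnitBall_lt p.2⟩
      invFun := fun b =>
        ((b : DiscreteIndex Unit × (EuclideanSpace ℝ (Fin 3) ×
            (Metric.sphere (0 : EuclideanSpace ℝ (Fin 2)) 1))).2.2,
          OpenPartialHomeomorph.univUnitBall.symm (b : DiscreteIndex Unit ×
            (EuclideanSpace ℝ (Fin 3) × (Metric.sphere (0 : EuclideanSpace ℝ (Fin 2)) 1))).2.1)
      left_inv := fun p => by
        ext : 1
        · rfl
        · exact OpenPartialHomeomorph.univUnitBall.left_inv (mem_univ _)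
      right_inv := fun b => by
        obtain ⟨⟨i, y, u⟩, hb⟩ := b
        refine Subtype.ext (Prod.ext rfl (Prod.ext ?_ rfl))
        exact OpenPartialHomeomorph.univUnitBall.right_inv (mem_ball_zero_iff.2 hb)
      continuous_toFun := Continuous.subtype_mk (continuous_const.prodMk
        ((continuous_univUnitBall.comp continuous_snd).prodMk continuous_fst)) _
      continuous_invFun := by
        refine (continuous_snd.comp (continuous_snd.comp continuous_subtype_val)).prodMk ?_
        exact OpenPartialHomeomorph.univUnitBall.continuousOn_symm.comp_continuous
          (continuous_fst.comp (continuous_snd.comp continuous_subtype_val))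
          fun b => mem_ball_zero_iff.2 b.2 }
  refine ⟨θ, ?_, ?_, fun p => rfl⟩
  · refine (ContMDiff.subtypeVal_comp_iff _ _).1 ?_
    exact contMDiff_const.prodMk
      ((OpenPartialHomeomorph.contDiff_univUnitBall.contMDiff.comp contMDiff_snd).prodMk contMDiff_fst)
  · have hs : ContMDiffOn 𝓘(ℝ, EuclideanSpace ℝ (Fin 3)) 𝓘(ℝ, EuclideanSpace ℝ (Fin 3)) ∞
        OpenPartialHomeomorph.univUnitBall.symm (ball (0 : EuclideanSpace ℝ (Fin 3)) 1) :=
      OpenPartialHomeomorph.contDiffOn_univUnitBall_symm.contMDiffOn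
    refine (contMDiff_snd.comp (contMDiff_snd.comp contMDiff_subtype_val)).prodMk ?_
    exact hs.comp_contMDiff (contMDiff_fst.comp (contMDiff_snd.comp contMDiff_subtype_val))
      fun b => mem_ball_zero_iff.2 b.2

/-! ### The core circle of the new piece and its tube -/

section Tube

variable {X' : Type*} [TopologicalSpace X'] [ChartedSpace (EuclideanSpace ℝ (Fin 4)) X']
  [IsManifold (𝓡 4) ∞ X']

omit [TopologicalSpace X'] [ChartedSpace (EuclideanSpace ℝ (Fin 4)) X'] [IsManifold (𝓡 4) ∞ X'] in
/-- The core `(⋆, 0, u)` lies in the new piece `Unit × OD³ × S¹`. [folklore] -/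
theorem zero_mem_ballTimesSphere (u : Metric.sphere (0 : EuclideanSpace ℝ (Fin 2)) 1) :
    (DiscreteIndex.mk (), (0 : EuclideanSpace ℝ (Fin 3)), u) ∈ ballTimesSphere Unit 2 1 := by
  simp

/-- **The core circle `ℓ(u) = jB(⋆, 0, u)` of an open smoothly embedded new piece
`jB : Unit × OD³ × S¹ ↪ X′` has a tubular neighbourhood filling the image of the piece**: the
`CircleNbhd` `(u, y) ↦ jB(⋆, y/√(1 + ‖y‖²), u)` — a globally defined partial diffeomorphism
`S¹ × ℝ³ ⇀ X′` (the reparametrisation `exists_theta` followed by `jB`), hence a smooth embedding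
(`isSmoothEmbedding_of_openPartialHomeomorph`, the inverse of `jB` being smooth by
`contMDiffOn_symm_of_isSmoothEmbedding`), with image `jB(Unit × OD³ × S¹)`. [cite: GompfStipsicz1999, §5.2] -/
theorem exists_circleNbhd_core (jB : ↥(ballTimesSphere Unit 2 1) → X')
    (hBs : Manifold.IsSmoothEmbedding ((𝓡 0).prod ((𝓡 3).prod (𝓡 1))) (𝓡 4) ∞ jB)
    (hBo : IsOpen (range jB)) :
    ∃ νc : CircleNbhd (𝓡 4) (fun u => jB ⟨(DiscreteIndex.mk (), 0, u), zero_mem_ballTimesSphere u⟩),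
      range νc.toFun = range jB ∧
      ∀ p, νc.toFun p = jB ⟨(DiscreteIndex.mk (), OpenPartialHomeomorph.univUnitBall p.2, p.1),
        norm_univUnitBall_lt p.2⟩ := by
  obtain ⟨θ, hθ, hθ', hθp⟩ := exists_theta
  have hB : IsOpenEmbedding jB := ⟨hBs.isEmbedding, hBo⟩
  have hθb : ∀ p, θ p = ⟨(DiscreteIndex.mk (), OpenPartialHomeomorph.univUnitBall p.2, p.1),
      norm_univUnitBall_lt p.2⟩ := fun p => Subtype.ext (hθp p)
  haveI : Nonempty ↥(ballTimesSphere Unit 2 1) := ⟨θ (⟨EuclideanSpace.single 0 1, by simp⟩, 0)⟩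
  set T := θ.toOpenPartialHomeomorph.trans (hB.toOpenPartialHomeomorph jB) with hT
  have hTs : T.source = univ := by simp [hT]
  have hTt : T.target = range jB := by
    rw [hT, OpenPartialHomeomorph.trans_target]
    simp
  have hTf : (T : _ → X') = jB ∘ θ := rfl
  have h1 : ContMDiffOn ((𝓡 1).prod 𝓘(ℝ, EuclideanSpace ℝ (Fin 3))) (𝓡 4) ∞ T T.source := by
    rw [hTf]
    exact (hBs.contMDiff.comp hθ).contMDiffOn
  have h2 : ContMDiffOn (𝓡 4) ((𝓡 1).prod 𝓘(ℝ, EuclideanSpace ℝ (Fin 3))) ∞ T.symm T.target := by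
    rw [hTt]
    exact hθ'.comp_contMDiffOn (contMDiffOn_symm_of_isSmoothEmbedding hBs hB)
  have hemb : Manifold.IsSmoothEmbedding ((𝓡 1).prod 𝓘(ℝ, EuclideanSpace ℝ (Fin 3))) (𝓡 4) ∞ T :=
    isSmoothEmbedding_of_openPartialHomeomorph T hTs h1 h2
      (ContinuousLinearEquiv.ofFinrankEq (by simp [Module.finrank_prod]))
  have hrange : range T = range jB := by
    rw [hTf]
    exact θ.surjective.range_comp jB
  refine ⟨{ toFun := T
            isSmoothEmbedding := hemb
            isOpen_range := hrange ▸ hBo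
            apply_zero := fun u => ?_ }, hrange, fun p => ?_⟩
  · show jB (θ (u, 0)) = _
    rw [hθb]
    congr 1
    exact Subtype.ext (Prod.ext rfl (Prod.ext OpenPartialHomeomorph.univUnitBall_apply_zero rfl))
  · show jB (θ p) = _
    rw [hθb]

end Tube

end SurgeryInversion

/-- **The core of an open smoothly embedded new piece `Unit × OD³ × S¹ ↪ X′` is a circle with a
tubular neighbourhood filling the image of the piece** (registered lemma of this auxiliary file):
for `jB` a smooth embedding with open range there are a loop `ℓ` (namely `u ↦ jB(⋆, 0, u)`) and a
`CircleNbhd` of it (namely `(u, y) ↦ jB(⋆, y/√(1 + ‖y‖²), u)`) whose image is the image of `jB`,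
such that `ℓ(u) = jB(⋆, 0, u)`. [cite: GompfStipsicz1999, §5.2] -/
theorem helper_exists_circleNbhd_newPieceCore :
    ∀ (X' : Type) [TopologicalSpace X'] [ChartedSpace (EuclideanSpace ℝ (Fin 4)) X'] [IsManifold (𝓡 4) ∞ X'] (jB : ↥(ballTimesSphere Unit 2 1) → X'), Manifold.IsSmoothEmbedding ((𝓡 0).prod ((𝓡 3).prod (𝓡 1))) (𝓡 4) ∞ jB → IsOpen (Set.range jB) → ∃ (ℓ : Metric.sphere (0 : EuclideanSpace ℝ (Fin 2)) 1 → X') (νc : CircleNbhd (𝓡 4) ℓ), Set.range νc.toFun = Set.range jB ∧ ∀ b : ↥(ballTimesSphere Unit 2 1), (b : DiscreteIndex Unit × (EuclideanSpace ℝ (Fin 3) × Metric.sphere (0 : EuclideanSpace ℝ (Fin 2)) 1)).2.1 = 0 → ℓ (b : DiscreteIndex Unit × (EuclideanSpace ℝ (Fin 3) × Metric.sphere (0 : EuclideanSpace ℝ (Fin 2)) 1)).2.2 = jB b := by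
  intro X' _ _ _ jB hBs hBo
  obtain ⟨νc, hr, -⟩ := SurgeryInversion.exists_circleNbhd_core jB hBs hBo
  refine ⟨_, νc, hr, fun b hb => ?_⟩
  obtain ⟨⟨i, y, u⟩, hb'⟩ := b
  change y = 0 at hb
  subst hb
  rfl

end Summit.SmoothPoincare4.SmoothPoincare4.Theorems

end
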